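import Summits.QuantumFields.YangMills.Theorems.UnitScaleTiltProp7SymAvgTwRightInverse
import Summits.QuantumFields.YangMills.Theorems.UnitScaleTiltProp7SymAvgRelDiffT3
import Summits.QuantumFields.YangMills.Theorems.UnitScaleTiltProp7SymAvgTwFrameBound
import HarnessLib

/-!
# `UnitScaleTiltProp7SymAvgTwOfRegPr` — THE Σ-TWIST LAYER AT A PRINTED-REGULAR BACKGROUND (OWNER RULING g26-№1 (2)∕(3c)∕(3d)∕(3e), assembled): with the differentiability rows `hG`, `hr` DISCHARGED
# (`Prop7SymAvgRelDiffT3.hasFDerivAt_rel_of_regPr`, `Prop7SymAvgTwFrameDiff.hasFDerivAt_frameTw_of_regPr`) — (i) **`QTw U₀ = QSym U₀ − D_{Ū₀} ∘ r`** at `RegPr`; (ii) **`QTw U₀ (D_{U₀}λ) = D_{Ū₀}(λ↓)`**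
# for gauge directions tangent to Ax_k(U₀); (iii) ★★★ **THE LETTER `H` OF (45)–(46)-tw ∕ `Chart47T3tw` ∕ (CH5EL-tw)** — an exact right inverse of print's `Q(U₀) = QTw U₀` with norm
# `(1 + C_Γ·C_r)·B_H`, from M12's `H^{sym}` — modulo exactly TWO displayed rows: the COVARIANTLY-CONSTANT EXTENSION `ȟ` ([Balaban1985Averaging] (58)∕(60): iterated comb transport from the
# `k`-centres) and the sup row of the linearised frames `‖r y A‖ ≤ C_r‖A‖`
# (route `UnitScaleTilt`, crux K1 «MinimiserStabilityRegPr» stmt-QuantumFields-19200, stub `stub_existenceMinimalOrbit` (EX), route (α), (AVG-SYM)∕M12; def-free, count-neutral)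

Cell `ym3-torus` (HUMAN RULING D-0037, YM ladder rung R3 — YM₃ on T³ is a rung, not d = 4, not a mass gap, not Clay), width seat `ym-ust-20520-w5` (gen 3).

THE PRINT.  [Balaban1985Variational] p. 285 (45)–(46) «QH = I, RD*H = 0 … |HB| ≦ B₀|B|»; [Balaban1985BackgroundPropagators] p. 392 («the averaging operation used here is the operation U̿ʲ defined by
the formulas (89)–(92) of [5]»), (3.14) p. 393, Thm 3.12; [Balaban1985Averaging] p. 27–28 (58)–(60) (axial gauge along the block contours `Γ_{y,x}`: «(R_{0,y}v)(x) = R(V₀(Γ_{y,x}))v(x)»), p. 28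
«A^λ_b = A_b − (D_{V₀}λ)(b)», (89)–(92) p. 31, (97)–(99) p. 32.

WHAT IS PROVED (sorry-free, no definition; standing hypotheses `RegPr F n K ε₀ U₀`, `10⁷L³ε₀ ≤ 1` and the three numeric windows at `α₀ = 2ε₀` of `Prop7SymAvgTwFrameDiff`):
* §1 ★★★**`QTw_apply_eq_of_regPr`** — `QTw U₀ A c = QSym U₀ A c − (r(c₋)A − Ū₀(c)·r(c₊)A·Ū₀(c)⁻¹)`, `r y = fderiv (A ↦ frameTw U₀ A y) 0`.
* §2 ★★★**`QTw_gaugeDir_of_regPr`** — for `λ` with `U₀♭^{e^{tλ}} ∈` Ax_k(U₀) near `t = 0`: `QTw U₀ (D_{U₀}λ) = (c ↦ λ(x̂c₋) − Ū₀(c)λ(x̂c₊)Ū₀(c)⁻¹)`.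
* §4 ★★★**`exists_rightInv_QTw_of_regPr_WS`** — the same with `C_r := 8∕(e·η)` DISCHARGED by `Prop7SymAvgTwFrameBound.norm_fderiv_frameTw_le_of_regPr`, the numeric windows being VERBATIM the
  (WΣ) list of `chartSigmaT3_of_regPr` at `(ε₀, e)` (already discharged in the knit by `Prop7ChartWindows.windowsS_of_small`): displayed rows left = `H^{sym}` (M12 ✓) and `ȟ` only.
* §3 ★★★**`exists_rightInv_QTw_of_regPr`** — given `H^{sym}` (`QSym∘H = id`, `‖HX‖ ≤ B_H‖X‖`), the row `ȟ` (ℂ-linear, `ȟ(η)(x̂y) = η(y)`, axial gauge curves, `‖D_{U₀}ȟ(η)‖ ≤ C_Γ‖η‖`) and the row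
  `‖r y A‖ ≤ C_r‖A‖`: `∃ H′` ℂ-linear, **`QTw U₀ ∘ H′ = id`**, **`‖H′X‖ ≤ (1 + C_Γ·C_r)·B_H·‖X‖`** (`H′ = H + (D_{U₀}∘ȟ)∘r∘H`, `Prop7SymAvgTwRightInverse.exists_rightInv_QTw_of_gaugeLift` with `hΓ` by §2).
HONEST FRAMING.  Assembly by name; displayed: `H^{sym}` (M12 ✓ supplier), `ȟ`, `C_r`, the ε₀-windows; (45)-tw `RD*H′ = 0` NOT claimed; nothing of print is asserted.  `--supports stmt-QuantumFields-19200 --as helper`.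

References: T. Bałaban, CMP 102 (1985) 277–309 [Balaban1985Variational] ((6) p.278, (44)–(49) p.285, Prop. 3 p.289); CMP 99 (1985) 389–434 [Balaban1985BackgroundPropagators] (p.392, (3.14)–(3.19) p.393,
Thm 3.12); CMP 98 (1985) 17–51 [Balaban1985Averaging] ((11) p.19, (58)–(60) pp.27–28, (87)–(92) p.31, (97)–(99) p.32); CMP 99 (1985) 75–102 [Balaban1985RegularSpaces] ((1.19) p.79, (1.139) p.100).
-/

set_option autoImplicit false

noncomputable section

open scoped Matrix.Norms.L2Operator Topology

namespace Summit.QuantumFields.YangMills.Theorems.Prop7SymAvgTwOfRegPr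

open NormedSpace Filter
open Literature.MathematicalPhysics.QuantumFieldTheory.Balaban1983to89
open Literature.MathematicalPhysics.QuantumFieldTheory.Balaban1983to89.T3ContinuumYM3Torus
open T3PrintedRegularMinimiser (RegPr)
open T3LevelShift (siteShift)
open T3PrintedRegularOrbits (sites_eq)
open T3SectALandauChart (bgUnits)
open B15DeterminingSets (embIter)
open B7Prop1Explicit (expUnit)
open B7Prop2Explicit (C0 c2')
open B8Eq119TwistedAxial (InAx)
open B8Thm4TorusAt (torusLam)
open B10Eq27TorusAxialLog (pull gaugeActT)
open Summit.QuantumFields.YangMills.Theorems.Prop7SPrint (basePt)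
open Summit.QuantumFields.YangMills.Theorems.Prop7SymAvgGL (descendToGL QSym)
open Summit.QuantumFields.YangMills.Theorems.Prop7SymAvgTw (frameTw QTw)
open Summit.QuantumFields.YangMills.Theorems.Prop7SymAvgTwBridge (QTw_eq_QSym_sub QTw_apply_eq)
open Summit.QuantumFields.YangMills.Theorems.Prop7SymAvgTwRightInverse (exists_rightInv_QTw_of_gaugeLift)
open Summit.QuantumFields.YangMills.Theorems.Prop7SymAvgTwGaugeDir (QTw_gaugeDir_of_inAx)
open Summit.QuantumFields.YangMills.Theorems.Prop7SymAvgRelDiffT3 (hasFDerivAt_rel_of_regPr)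
open Summit.QuantumFields.YangMills.Theorems.Prop7SymAvgTwFrameDiff (hasFDerivAt_frameTw_of_regPr)

variable (F : T3Family) {n K : ℕ} (h : n ≤ K)

/-! ## §1 The bridge `QTw = QSym − D_{Ū₀} ∘ r` at a printed-regular background (both differentiability rows discharged) -/

/-- ★★★ **`QTw U₀ = QSym U₀ − D_{Ū₀} ∘ r` AT EVERY PRINTED-REGULAR BACKGROUND** (`RegPr F n K ε₀ U₀`, `10⁷L³ε₀ ≤ 1`, the three numeric windows at `α₀ = 2ε₀`), with the linearised frames
`r y := fderiv (A ↦ frameTw U₀ A y) 0` — `Prop7SymAvgTwBridge.QTw_eq_QSym_sub` with `hG` from `Prop7SymAvgRelDiffT3.hasFDerivAt_rel_of_regPr` and `hr` from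
`Prop7SymAvgTwFrameDiff.hasFDerivAt_frameTw_of_regPr`.  (RULING g26-№1 (2): the first bridge, now unconditional at `RegPr`.)
[cite: Balaban1985BackgroundPropagators, (3.14)–(3.15) p.393; Balaban1985Averaging, (89) p.31, (97) p.32, p.28; Balaban1985Variational, (6) p.278, (44) p.285] -/
theorem QTw_apply_eq_of_regPr {ε₀ : ℝ} (hε₀ : 0 < ε₀) (hε : 10 ^ 7 * (F.L : ℝ) ^ 3 * ε₀ ≤ 1)
    (hα3 : C0 (F.P K).d * (2 * ε₀) ≤ 1 / 3) (hα4 : 4 * (2 * ε₀) ≤ c2' (F.P K).d (F.P K).L)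
    (hexp : Real.exp (4 * (800 * (((F.P K).d : ℝ) + 1) ^ 2 * (((F.P K).d : ℝ) + 4)) * (2 * ε₀)) < 2)
    (U₀ : GaugeField (F.P K) 0 (Matrix.specialUnitaryGroup (Fin 2) ℂ)) (hreg : RegPr F n K ε₀ U₀)
    (A : PBond (F.P K) 0 → Matrix (Fin 2) (Fin 2) ℂ) (c : PBond (F.P n) 0) :
    QTw F n K h U₀ A c = QSym F n K h U₀ A c
      - (fderiv ℂ (fun A : PBond (F.P K) 0 → Matrix (Fin 2) (Fin 2) ℂ => ((frameTw F n K h U₀ A c.src : (Matrix (Fin 2) (Fin 2) ℂ)ˣ) : Matrix (Fin 2) (Fin 2) ℂ)) 0 A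
          - ((descendToGL F n K h (bgUnits F K U₀) c : (Matrix (Fin 2) (Fin 2) ℂ)ˣ) : Matrix (Fin 2) (Fin 2) ℂ)
              * fderiv ℂ (fun A : PBond (F.P K) 0 → Matrix (Fin 2) (Fin 2) ℂ => ((frameTw F n K h U₀ A c.tgt : (Matrix (Fin 2) (Fin 2) ℂ)ˣ) : Matrix (Fin 2) (Fin 2) ℂ)) 0 A
              * (((descendToGL F n K h (bgUnits F K U₀) c)⁻¹ : (Matrix (Fin 2) (Fin 2) ℂ)ˣ) : Matrix (Fin 2) (Fin 2) ℂ)) :=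
  QTw_apply_eq F h U₀ (hasFDerivAt_rel_of_regPr F h hε₀ hε U₀ hreg) (hasFDerivAt_frameTw_of_regPr F h hε₀ hα3 hα4 hexp U₀ hreg) A c

/-! ## §2 The twisted average of a gauge direction tangent to the axial slice, at a printed-regular background -/

/-- ★★★ **`QTw U₀ (D_{U₀}λ) = D_{Ū₀}(λ↓)` AT `RegPr`** for every `λ` whose gauge curve `U₀♭^{e^{tλ}}` stays in Ax_k(U₀) near `t = 0` (`Prop7SymAvgTwGaugeDir.QTw_gaugeDir_of_inAx` with `hG`, `hr`
discharged). [cite: Balaban1985Averaging, (11) p.19, p.28, (87)–(92) p.31; Balaban1985RegularSpaces, (1.19) p.79; Balaban1985BackgroundPropagators, (3.14), (3.19) p.393] -/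
theorem QTw_gaugeDir_of_regPr {ε₀ : ℝ} (hε₀ : 0 < ε₀) (hε : 10 ^ 7 * (F.L : ℝ) ^ 3 * ε₀ ≤ 1)
    (hα3 : C0 (F.P K).d * (2 * ε₀) ≤ 1 / 3) (hα4 : 4 * (2 * ε₀) ≤ c2' (F.P K).d (F.P K).L)
    (hexp : Real.exp (4 * (800 * (((F.P K).d : ℝ) + 1) ^ 2 * (((F.P K).d : ℝ) + 4)) * (2 * ε₀)) < 2)
    (U₀ : GaugeField (F.P K) 0 (Matrix.specialUnitaryGroup (Fin 2) ℂ)) (hreg : RegPr F n K ε₀ U₀)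
    (lam : Site (F.P K) 0 → Matrix (Fin 2) (Fin 2) ℂ)
    (hAx : ∀ᶠ t : ℂ in nhds 0, InAx (F.P K).L (K - n) (torusLam (K - n)) (pull (bgUnits F K U₀) (basePt F n K))
      (pull (gaugeActT (fun x => expUnit (t • lam x)) (bgUnits F K U₀)) (basePt F n K))) :
    QTw F n K h U₀ (fun b : PBond (F.P K) 0 =>
        lam b.src - ((bgUnits F K U₀ b : (Matrix (Fin 2) (Fin 2) ℂ)ˣ) : Matrix (Fin 2) (Fin 2) ℂ) * lam b.tgt
          * (((bgUnits F K U₀ b)⁻¹ : (Matrix (Fin 2) (Fin 2) ℂ)ˣ) : Matrix (Fin 2) (Fin 2) ℂ))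
      = fun c : PBond (F.P n) 0 =>
        lam (embIter (K - n) (siteShift (sites_eq F n K h) c.src))
          - ((descendToGL F n K h (bgUnits F K U₀) c : (Matrix (Fin 2) (Fin 2) ℂ)ˣ) : Matrix (Fin 2) (Fin 2) ℂ) * lam (embIter (K - n) (siteShift (sites_eq F n K h) c.tgt))
            * (((descendToGL F n K h (bgUnits F K U₀) c)⁻¹ : (Matrix (Fin 2) (Fin 2) ℂ)ˣ) : Matrix (Fin 2) (Fin 2) ℂ) :=
  QTw_gaugeDir_of_inAx F h U₀ (hasFDerivAt_rel_of_regPr F h hε₀ hε U₀ hreg) (hasFDerivAt_frameTw_of_regPr F h hε₀ hα3 hα4 hexp U₀ hreg) lam hAx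

/-! ## §3 ★ (46)-tw AT A PRINTED-REGULAR BACKGROUND: the twisted right inverse from M12's `H^{sym}` and the covariantly-constant extension `ȟ` -/

/-- ★★★ **THE LETTER `H` OF (45)–(46)-tw ∕ `Chart47T3tw` ∕ (CH5EL-tw) AT A PRINTED-REGULAR BACKGROUND** (RULING g26-№1 (2)∕(3e), both bridges composed, `hG`∕`hr` discharged): given
(i) M12's right inverse `H` of the SYMMETRIC linearised average with its sup row (`QSym U₀ (HX) = X`, `‖HX‖ ≤ B_H‖X‖` — ✓ `Prop7HSym` ∕ `…HSymObLift` ∕ ★w3's (hQR)-assembly),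
(ii) THE COVARIANTLY-CONSTANT EXTENSION `ȟ` — a ℂ-linear map from coarse gauge parameters `η : T^{(n)}_0 → M₂` to fine ones with `ȟ(η)(x̂ y) = η(y)` at the centres, whose gauge curves
`U₀♭^{e^{tȟ(η)}}` stay in print's axial gauge Ax_k(U₀) (based (1.19)) near `t = 0`, and with `‖D_{U₀}ȟ(η)‖ ≤ C_Γ‖η‖` (DISPLAYED — the iterated comb transport of `η` from the `k`-centres
level by level; [Balaban1985Averaging] (58)∕(60)),
(iii) a sup row for the linearised frames `‖r y A‖ ≤ C_r‖A‖`, `r y = fderiv (A ↦ frameTw U₀ A y) 0` (DISPLAYED; RULING g26-№1 (3c): `C_r ≲ d·L^{K−n}`),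
there is a ℂ-linear `H′` with **`QTw U₀ (H′X) = X`** and **`‖H′X‖ ≤ (1 + C_Γ·C_r)·B_H·‖X‖`** — `H′ = H + (D_{U₀}∘ȟ) ∘ r ∘ H`.
[cite: Balaban1985Variational, (45)–(46) p.285, Prop. 3 p.289; Balaban1985BackgroundPropagators, Thm 3.12, (3.14) p.393; Balaban1985Averaging, p.28, (58)–(60) pp.27–28, (89)–(92) p.31] -/
theorem exists_rightInv_QTw_of_regPr {ε₀ : ℝ} (hε₀ : 0 < ε₀) (hε : 10 ^ 7 * (F.L : ℝ) ^ 3 * ε₀ ≤ 1)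
    (hα3 : C0 (F.P K).d * (2 * ε₀) ≤ 1 / 3) (hα4 : 4 * (2 * ε₀) ≤ c2' (F.P K).d (F.P K).L)
    (hexp : Real.exp (4 * (800 * (((F.P K).d : ℝ) + 1) ^ 2 * (((F.P K).d : ℝ) + 4)) * (2 * ε₀)) < 2)
    (U₀ : GaugeField (F.P K) 0 (Matrix.specialUnitaryGroup (Fin 2) ℂ)) (hreg : RegPr F n K ε₀ U₀)
    -- (i) M12's symmetric right inverse
    (H : (PBond (F.P n) 0 → Matrix (Fin 2) (Fin 2) ℂ) →ₗ[ℂ] (PBond (F.P K) 0 → Matrix (Fin 2) (Fin 2) ℂ)) (hH : ∀ X, QSym F n K h U₀ (H X) = X)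
    {BH : ℝ} (hHb : ∀ X, ‖H X‖ ≤ BH * ‖X‖)
    -- (ii) the covariantly-constant extension (displayed row)
    (hExt : (Site (F.P n) 0 → Matrix (Fin 2) (Fin 2) ℂ) →ₗ[ℂ] (Site (F.P K) 0 → Matrix (Fin 2) (Fin 2) ℂ))
    (hExt_centre : ∀ (η : Site (F.P n) 0 → Matrix (Fin 2) (Fin 2) ℂ) (y : Site (F.P n) 0), hExt η (embIter (K - n) (siteShift (sites_eq F n K h) y)) = η y)
    (hExt_ax : ∀ η : Site (F.P n) 0 → Matrix (Fin 2) (Fin 2) ℂ, ∀ᶠ t : ℂ in nhds 0,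
      InAx (F.P K).L (K - n) (torusLam (K - n)) (pull (bgUnits F K U₀) (basePt F n K))
        (pull (gaugeActT (fun x => expUnit (t • hExt η x)) (bgUnits F K U₀)) (basePt F n K)))
    {CΓ : ℝ} (hCΓ : 0 ≤ CΓ)
    (hExt_b : ∀ η : Site (F.P n) 0 → Matrix (Fin 2) (Fin 2) ℂ,
      ‖(fun b : PBond (F.P K) 0 => hExt η b.src - ((bgUnits F K U₀ b : (Matrix (Fin 2) (Fin 2) ℂ)ˣ) : Matrix (Fin 2) (Fin 2) ℂ) * hExt η b.tgt
          * (((bgUnits F K U₀ b)⁻¹ : (Matrix (Fin 2) (Fin 2) ℂ)ˣ) : Matrix (Fin 2) (Fin 2) ℂ))‖ ≤ CΓ * ‖η‖)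
    -- (iii) the sup row of the linearised frames (displayed row)
    {Cr : ℝ} (hCr : 0 ≤ Cr)
    (hrb : ∀ (y : Site (F.P n) 0) (A : PBond (F.P K) 0 → Matrix (Fin 2) (Fin 2) ℂ),
      ‖fderiv ℂ (fun A : PBond (F.P K) 0 → Matrix (Fin 2) (Fin 2) ℂ => ((frameTw F n K h U₀ A y : (Matrix (Fin 2) (Fin 2) ℂ)ˣ) : Matrix (Fin 2) (Fin 2) ℂ)) 0 A‖ ≤ Cr * ‖A‖) :
    ∃ H' : (PBond (F.P n) 0 → Matrix (Fin 2) (Fin 2) ℂ) →ₗ[ℂ] (PBond (F.P K) 0 → Matrix (Fin 2) (Fin 2) ℂ),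
      (∀ X, QTw F n K h U₀ (H' X) = X) ∧ (∀ X, ‖H' X‖ ≤ (1 + CΓ * Cr) * BH * ‖X‖) := by
  -- the gauge lift `Γ := D_{U₀} ∘ ȟ`, linear
  let Γ : (Site (F.P n) 0 → Matrix (Fin 2) (Fin 2) ℂ) →ₗ[ℂ] (PBond (F.P K) 0 → Matrix (Fin 2) (Fin 2) ℂ) :=
    { toFun := fun η b => hExt η b.src - ((bgUnits F K U₀ b : (Matrix (Fin 2) (Fin 2) ℂ)ˣ) : Matrix (Fin 2) (Fin 2) ℂ) * hExt η b.tgt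
          * (((bgUnits F K U₀ b)⁻¹ : (Matrix (Fin 2) (Fin 2) ℂ)ˣ) : Matrix (Fin 2) (Fin 2) ℂ)
      map_add' := fun η η' => by
        funext b
        simp only [map_add, Pi.add_apply]
        noncomm_ring
      map_smul' := fun a η => by
        funext b
        simp only [map_smul, Pi.smul_apply, RingHom.id_apply, Matrix.mul_smul, Matrix.smul_mul, smul_sub] }
  have hΓ_apply : ∀ η, Γ η = fun b : PBond (F.P K) 0 => hExt η b.src - ((bgUnits F K U₀ b : (Matrix (Fin 2) (Fin 2) ℂ)ˣ) : Matrix (Fin 2) (Fin 2) ℂ) * hExt η b.tgt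
      * (((bgUnits F K U₀ b)⁻¹ : (Matrix (Fin 2) (Fin 2) ℂ)ˣ) : Matrix (Fin 2) (Fin 2) ℂ) := fun η => rfl
  -- `QTw (Γη) = D_{Ū₀}η` by §2 at `λ = ȟ(η)`
  have hΓ : ∀ (η : Site (F.P n) 0 → Matrix (Fin 2) (Fin 2) ℂ) (c : PBond (F.P n) 0),
      QTw F n K h U₀ (Γ η) c = η c.src - ((descendToGL F n K h (bgUnits F K U₀) c : (Matrix (Fin 2) (Fin 2) ℂ)ˣ) : Matrix (Fin 2) (Fin 2) ℂ) * η c.tgt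
        * (((descendToGL F n K h (bgUnits F K U₀) c)⁻¹ : (Matrix (Fin 2) (Fin 2) ℂ)ˣ) : Matrix (Fin 2) (Fin 2) ℂ) := by
    intro η c
    rw [hΓ_apply, QTw_gaugeDir_of_regPr F h hε₀ hε hα3 hα4 hexp U₀ hreg (hExt η) (hExt_ax η)]
    beta_reduce
    erw [hExt_centre η c.src, hExt_centre η c.tgt]
  exact exists_rightInv_QTw_of_gaugeLift F h U₀ (hasFDerivAt_rel_of_regPr F h hε₀ hε U₀ hreg) (hasFDerivAt_frameTw_of_regPr F h hε₀ hα3 hα4 hexp U₀ hreg)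
    hCr hrb H hH hHb Γ hΓ hCΓ (fun η => by rw [hΓ_apply]; exact hExt_b η)

/-! ## §4 The same with the `‖r‖` row discharged (`C_r = 8∕R`, `R = e·η`) — windows VERBATIM the (WΣ) list of `chartSigmaT3_of_regPr` ∕ `Prop7ChartWindows.windowsS_of_small` -/

/-- ★★★ **(46)-tw AT A PRINTED-REGULAR BACKGROUND WITH `C_r` DISCHARGED**: as `exists_rightInv_QTw_of_regPr`, the sup row of the linearised frames now supplied by
`Prop7SymAvgTwFrameBound.norm_fderiv_frameTw_le_of_regPr` at the radius `R := e·η` (`η = L^{−(K−n)}`), so that the five numeric windows read EXACTLY as the (WΣ) windows of ★w5 g0's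
`Prop7ChartSigmaT3OfRegPr.chartSigmaT3_of_regPr` at `(ε₀, e)` (discharged in the knit by ★w2-19200 g2's `Prop7ChartWindows.windowsS_of_small` from `2ε₀·L² ≤ 10⁻⁹`, `e·L² ≤ 10⁻⁹`):
`∃ H′`, `QTw U₀ ∘ H′ = id`, **`‖H′X‖ ≤ (1 + C_Γ·(8∕(e·η)))·B_H·‖X‖`** — displayed rows left: M12's `H^{sym}` and the covariantly-constant extension `ȟ` only.
[cite: Balaban1985Variational, (45)–(46) p.285; Balaban1985BackgroundPropagators, Thm 3.12, (3.14) p.393; Balaban1985Averaging, (58)–(60) pp.27–28, (161)–(163) p.42] -/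
theorem exists_rightInv_QTw_of_regPr_WS {ε₀ e : ℝ} (hε₀ : 0 < ε₀) (hε : 10 ^ 7 * (F.L : ℝ) ^ 3 * ε₀ ≤ 1) (he : 0 < e)
    (hα3 : C0 (F.P K).d * (2 * ε₀) ≤ 1 / 3) (hα4 : 4 * (2 * ε₀) ≤ c2' (F.P K).d (F.P K).L)
    (hsmall : Real.exp (4 * (800 * (((F.P K).d : ℝ) + 1) ^ 2 * (((F.P K).d : ℝ) + 4)) * (2 * ε₀))
      * (1 + 8 * (131072 * (((F.P K).d : ℝ) + 1) ^ 2) * e) ≤ 2)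
    (hc₃ : 2 * e ≤ B7Prop3Flat.c3 (F.P K).d (F.P K).L) (hsm : 2048 * ((F.P K).d : ℝ) * e ≤ 1)
    (U₀ : GaugeField (F.P K) 0 (Matrix.specialUnitaryGroup (Fin 2) ℂ)) (hreg : RegPr F n K ε₀ U₀)
    (H : (PBond (F.P n) 0 → Matrix (Fin 2) (Fin 2) ℂ) →ₗ[ℂ] (PBond (F.P K) 0 → Matrix (Fin 2) (Fin 2) ℂ)) (hH : ∀ X, QSym F n K h U₀ (H X) = X)
    {BH : ℝ} (hHb : ∀ X, ‖H X‖ ≤ BH * ‖X‖)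
    (hExt : (Site (F.P n) 0 → Matrix (Fin 2) (Fin 2) ℂ) →ₗ[ℂ] (Site (F.P K) 0 → Matrix (Fin 2) (Fin 2) ℂ))
    (hExt_centre : ∀ (η : Site (F.P n) 0 → Matrix (Fin 2) (Fin 2) ℂ) (y : Site (F.P n) 0), hExt η (embIter (K - n) (siteShift (sites_eq F n K h) y)) = η y)
    (hExt_ax : ∀ η : Site (F.P n) 0 → Matrix (Fin 2) (Fin 2) ℂ, ∀ᶠ t : ℂ in nhds 0,
      InAx (F.P K).L (K - n) (torusLam (K - n)) (pull (bgUnits F K U₀) (basePt F n K))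
        (pull (gaugeActT (fun x => expUnit (t • hExt η x)) (bgUnits F K U₀)) (basePt F n K)))
    {CΓ : ℝ} (hCΓ : 0 ≤ CΓ)
    (hExt_b : ∀ η : Site (F.P n) 0 → Matrix (Fin 2) (Fin 2) ℂ,
      ‖(fun b : PBond (F.P K) 0 => hExt η b.src - ((bgUnits F K U₀ b : (Matrix (Fin 2) (Fin 2) ℂ)ˣ) : Matrix (Fin 2) (Fin 2) ℂ) * hExt η b.tgt
          * (((bgUnits F K U₀ b)⁻¹ : (Matrix (Fin 2) (Fin 2) ℂ)ˣ) : Matrix (Fin 2) (Fin 2) ℂ))‖ ≤ CΓ * ‖η‖) :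
    ∃ H' : (PBond (F.P n) 0 → Matrix (Fin 2) (Fin 2) ℂ) →ₗ[ℂ] (PBond (F.P K) 0 → Matrix (Fin 2) (Fin 2) ℂ),
      (∀ X, QTw F n K h U₀ (H' X) = X) ∧ (∀ X, ‖H' X‖ ≤ (1 + CΓ * (8 / (e * T3SectALandauChart.eta F n K))) * BH * ‖X‖) := by
  have hη : 0 < T3SectALandauChart.eta F n K := T3SectALandauChart.eta_pos F n K
  set R : ℝ := e * T3SectALandauChart.eta F n K with hR
  have hR0 : 0 < R := by positivity
  have hL0 : (0 : ℝ) < ((F.P K).L : ℝ) := by exact_mod_cast (F.P K).L_pos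
  have hLη : ((F.P K).L : ℝ) ^ (K - n) * T3SectALandauChart.eta F n K = 1 := by
    show ((F.L : ℕ) : ℝ) ^ (K - n) * ((F.L : ℝ)⁻¹) ^ (K - n) = 1
    rw [inv_pow]
    exact mul_inv_cancel₀ (pow_ne_zero _ (by exact_mod_cast hL0.ne'))
  have hLR : ((F.P K).L : ℝ) ^ (K - n) * R = e := by rw [hR, mul_left_comm, hLη, mul_one]
  -- the strict exponential window from `hsmall` (`1 + 8C₁e > 1`)
  have hexp : Real.exp (4 * (800 * (((F.P K).d : ℝ) + 1) ^ 2 * (((F.P K).d : ℝ) + 4)) * (2 * ε₀)) < 2 := by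
    have hpos : 0 < 8 * (131072 * (((F.P K).d : ℝ) + 1) ^ 2) * e := by positivity
    have hE : 0 < Real.exp (4 * (800 * (((F.P K).d : ℝ) + 1) ^ 2 * (((F.P K).d : ℝ) + 4)) * (2 * ε₀)) := Real.exp_pos _
    nlinarith
  refine exists_rightInv_QTw_of_regPr F h hε₀ hε hα3 hα4 hexp U₀ hreg H hH hHb hExt hExt_centre hExt_ax hCΓ hExt_b (Cr := 8 / R) (by positivity) ?_
  intro y A
  exact Prop7SymAvgTwFrameBound.norm_fderiv_frameTw_le_of_regPr F h hε₀ hR0 hα3 hα4 (by rw [hLR]; exact hsmall) (by rw [hLR]; exact hc₃)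
    (by rw [hLR]; exact hsm) U₀ hreg y A

end Summit.QuantumFields.YangMills.Theorems.Prop7SymAvgTwOfRegPr

end
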